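import Mathlib.Analysis.SpecificLimits.Basic
import Summits.KontsevichZagierPeriods.Zeta5Search.Zudilin2003Growth
import HarnessLib

/-!
# ζ(5) search — Casoratian and convergence of Zudilin's Catalan approximants (cell `pub-zeta5`, TYPER)

HONEST FRAMING: systematic search; no irrationality claim unless certified.

Sequel of `Zudilin2003Growth.lean` (Catalan arm, criterion C3): the remaining FORMAT A fields for
Zudilin's 2003 second-order recursion — here Abel's formula (`RecurrenceGrowth.casoratian_eq_prod_mul`)
gives the Casoratian in CLOSED form, so everything is an identity plus the growth bracket:

* `vR_rec` — the second printed solution `vₙ` (`v₀ = 0, v₁ = 13/8`) solves the same recursion;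
* `casoratian_eq` — `uₙ v_{n+1} - u_{n+1} vₙ = (∏_{i<n} tᵢ) · 13/8` with `-1 ≤ tᵢ < 0`
  (`abs_tC_le_one`: the cleared inequality `TC ≤ LC` is a polynomial with nonnegative coefficients);
* `casoratian_ne_zero`, `abs_casoratian_le` — `uₙ v_{n+1} ≠ u_{n+1} vₙ` and
  `|uₙ v_{n+1} - u_{n+1} vₙ| ≤ 13/8` for every `n`;
* `abs_ratio_step_le`, `exists_limit` — `|v_{3+m}/u_{3+m} - v_{2+m}/u_{2+m}| ≤ K θ^m` with
  `K = (13/8)/((649/64)² · (15/2))`, `θ = 4/225 = (2/15)²` (`log θ = -4.03…`; the paper's rate is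
  `2 log((1+√5)/2)⁵ = 4.81`), hence `vₙ/uₙ` converges to some `L` with
  `|v_{2+m}/u_{2+m} - L| ≤ K θ^m/(1-θ)`;
* `abs_sub_catalan_le_of_theorem1` — CONDITIONAL on the tree's named fact `Zudilin2003.theorem1`
  (`vₙ/uₙ → G`), the same bound for `|G - v_{2+m}/u_{2+m}|`.

Everything is PROVED (0 sorry); inputs are the tree's definitions only.
-/

noncomputable section

open Filter Topology Finset
open Literature.NumberTheory.Irrationality.Zudilin2003
open Literature.NumberTheory.Transcendental

namespace Summit.KontsevichZagierPeriods.Zeta5Search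

namespace Zudilin2003Growth

/-! ### The second solution -/

/-- `vₙ` as a real sequence. -/
def vR (n : ℕ) : ℝ := (v n : ℝ)

/-- **The recursion for `v` over `ℝ`**: `v_{m+2} = s_m v_{m+1} - t_m v_m`. -/
theorem vR_rec (m : ℕ) : vR (m + 2) = sC m * vR (m + 1) - tC m * vR m := by
  have hL : LC m ≠ 0 := (LC_pos m).ne'
  have h : v (m + 2) = step m (v m) (v (m + 1)) := by
    unfold v; exact sol_step _ _ m
  have h' := congrArg (fun x : ℚ => (x : ℝ)) h
  simp only [step, p, q] at h'
  push_cast at h'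
  unfold vR sC tC TC LC
  simp only [p, q] at hL ⊢
  rw [h']
  field_simp
  ring

/-! ### The coefficient `t_m ∈ [-1, 0)` -/

/-- `TC_m > 0` (so `t_m < 0`). -/
theorem TC_pos (m : ℕ) : 0 < TC m := by
  unfold TC; rw [p_add_two]; positivity

/-- `t_m ≠ 0`. -/
theorem tC_ne_zero (m : ℕ) : tC m ≠ 0 := by
  unfold tC
  exact div_ne_zero (neg_ne_zero.2 (TC_pos m).ne') (LC_pos m).ne'

/-- `|t_m| ≤ 1`: the cleared inequality `TC_m ≤ LC_m` is
`1612 + 7128m + 12240m² + 10176m³ + 4096m⁴ + 640m⁵ ≥ 0`. -/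
theorem abs_tC_le_one (m : ℕ) : |tC m| ≤ 1 := by
  have hL := LC_pos m
  have hT := TC_pos m
  have hdiff : LC m - TC m = 1612 + 7128 * (m : ℝ) + 12240 * (m : ℝ) ^ 2 + 10176 * (m : ℝ) ^ 3 +
      4096 * (m : ℝ) ^ 4 + 640 * (m : ℝ) ^ 5 := by
    unfold LC TC; simp only [p]; ring
  have hle : TC m ≤ LC m := by
    have : (0 : ℝ) ≤ LC m - TC m := by rw [hdiff]; positivity
    linarith
  unfold tC
  rw [neg_div, abs_neg, abs_div, abs_of_pos hT, abs_of_pos hL, div_le_one hL]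
  exact hle

/-! ### The Casoratian in closed form -/

/-- **Abel's formula for Zudilin's Catalan recursion**:
`uₙ v_{n+1} - u_{n+1} vₙ = (∏_{i<n} tᵢ) · 13/8`. -/
theorem casoratian_eq (n : ℕ) :
    uR n * vR (n + 1) - uR (n + 1) * vR n = (∏ i ∈ range n, tC i) * (13 / 8) := by
  have h := casoratian_eq_prod_mul uR vR sC tC 0 (fun m _ => uR_rec m) (fun m _ => vR_rec m) n
    (Nat.zero_le n)
  rw [h, range_eq_Ico]
  congr 1
  unfold uR vR u v
  rw [sol_zero, sol_one, sol_zero, sol_one]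
  norm_num

/-- **Non-vanishing**: `uₙ v_{n+1} ≠ u_{n+1} vₙ` for every `n` (consecutive approximants are distinct). -/
theorem casoratian_ne_zero (n : ℕ) : uR n * vR (n + 1) - uR (n + 1) * vR n ≠ 0 := by
  rw [casoratian_eq]
  exact mul_ne_zero (prod_ne_zero_iff.2 fun i _ => tC_ne_zero i) (by norm_num)

/-- **Casoratian bound**: `|uₙ v_{n+1} - u_{n+1} vₙ| ≤ 13/8` for every `n`. -/
theorem abs_casoratian_le (n : ℕ) : |uR n * vR (n + 1) - uR (n + 1) * vR n| ≤ 13 / 8 := by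
  rw [casoratian_eq, abs_mul, abs_prod, abs_of_pos (by norm_num : (0 : ℝ) < 13 / 8)]
  have h : ∏ i ∈ range n, |tC i| ≤ 1 := by
    calc ∏ i ∈ range n, |tC i| ≤ ∏ i ∈ range n, (1 : ℝ) :=
          prod_le_prod (fun i _ => abs_nonneg _) fun i _ => abs_tC_le_one i
      _ = 1 := by simp
  nlinarith [prod_nonneg fun i (_ : i ∈ range n) => abs_nonneg (tC i)]

/-! ### Convergence of the approximants `vₙ/uₙ` -/

/-- **One step, explicit geometric bound**: for every `m`,
`|v_{3+m}/u_{3+m} - v_{2+m}/u_{2+m}| ≤ K θ^m` with `K = (13/8)/((649/64)²·(15/2))`, `θ = 4/225`. -/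
theorem abs_ratio_step_le (m : ℕ) :
    |vR (2 + m + 1) / uR (2 + m + 1) - vR (2 + m) / uR (2 + m)| ≤
      13 / 8 / ((649 / 64) ^ 2 * (15 / 2)) * (4 / 225) ^ m := by
  have hn : 2 ≤ 2 + m := by omega
  have hu0 : 0 < uR (2 + m) := (ratio_bounds (2 + m) hn).1
  have hu1 : 0 < uR (2 + m + 1) := (ratio_bounds (2 + m + 1) (by omega)).1
  have hid : vR (2 + m + 1) / uR (2 + m + 1) - vR (2 + m) / uR (2 + m) =
      (uR (2 + m) * vR (2 + m + 1) - uR (2 + m + 1) * vR (2 + m)) / (uR (2 + m) * uR (2 + m + 1)) := by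
    field_simp
  rw [hid, abs_div, abs_of_pos (mul_pos hu0 hu1)]
  have hW := abs_casoratian_le (2 + m)
  -- denominators: `u (2+m) ≥ (649/64)(15/2)^m`, `u (2+m+1) ≥ (649/64)(15/2)^(m+1)`
  have hq0 : 649 / 64 * (15 / 2 : ℝ) ^ m ≤ uR (2 + m) := le_u m
  have hq1 : 649 / 64 * (15 / 2 : ℝ) ^ (m + 1) ≤ uR (2 + m + 1) := by
    have h := le_u (m + 1)
    rwa [show 2 + (m + 1) = 2 + m + 1 by ring] at h
  have hpos0 : (0 : ℝ) < 649 / 64 * (15 / 2) ^ m := by positivity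
  have hpos1 : (0 : ℝ) < 649 / 64 * (15 / 2) ^ (m + 1) := by positivity
  have hden : 649 / 64 * (15 / 2 : ℝ) ^ m * (649 / 64 * (15 / 2) ^ (m + 1)) ≤
      uR (2 + m) * uR (2 + m + 1) := mul_le_mul hq0 hq1 hpos1.le hu0.le
  calc |uR (2 + m) * vR (2 + m + 1) - uR (2 + m + 1) * vR (2 + m)| / (uR (2 + m) * uR (2 + m + 1))
      ≤ (13 / 8) / (649 / 64 * (15 / 2 : ℝ) ^ m * (649 / 64 * (15 / 2) ^ (m + 1))) := by
        gcongr
    _ = 13 / 8 / ((649 / 64) ^ 2 * (15 / 2)) * (4 / 225) ^ m := by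
        have hX : (0 : ℝ) < (15 / 2) ^ m := by positivity
        have e1 : (4 / 225 : ℝ) ^ m = (((15 / 2 : ℝ) ^ m)⁻¹) ^ 2 := by
          rw [show (4 / 225 : ℝ) = ((15 / 2)⁻¹) ^ 2 by norm_num, ← pow_mul, Nat.mul_comm 2 m,
            pow_mul, inv_pow]
        rw [e1, pow_succ]
        field_simp

/-- **The approximants converge geometrically**: there is `L` with `vₙ/uₙ → L` and
`|v_{2+m}/u_{2+m} - L| ≤ K θ^m/(1 - θ)` for every `m`. -/
theorem exists_limit :
    ∃ L : ℝ, Tendsto (fun n : ℕ => vR n / uR n) atTop (𝓝 L) ∧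
      ∀ m : ℕ, |vR (2 + m) / uR (2 + m) - L| ≤
        13 / 8 / ((649 / 64) ^ 2 * (15 / 2)) * (4 / 225) ^ m / (1 - 4 / 225) := by
  set f : ℕ → ℝ := fun m => vR (2 + m) / uR (2 + m) with hf
  have hθ : (4 / 225 : ℝ) < 1 := by norm_num
  have hstep : ∀ m, dist (f m) (f (m + 1)) ≤ 13 / 8 / ((649 / 64) ^ 2 * (15 / 2)) * (4 / 225 : ℝ) ^ m := by
    intro m
    rw [dist_comm, Real.dist_eq, hf]
    simp only
    rw [show 2 + (m + 1) = 2 + m + 1 by ring]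
    exact abs_ratio_step_le m
  have hcauchy := cauchySeq_of_le_geometric _ _ hθ hstep
  obtain ⟨L, hL⟩ := cauchySeq_tendsto_of_complete hcauchy
  refine ⟨L, ?_, fun m => ?_⟩
  · have h2 : Tendsto (fun m : ℕ => vR (m + 2) / uR (m + 2)) atTop (𝓝 L) :=
      hL.congr fun m => by simp only [hf, add_comm]
    exact (tendsto_add_atTop_iff_nat 2).1 h2
  · have h := dist_le_of_le_geometric_of_tendsto _ _ hθ hstep hL m
    rwa [Real.dist_eq] at h

/-- **Conditional approximation rate for Catalan's constant**: under the tree's named fact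
`Zudilin2003.theorem1` (which contains `vₙ/uₙ → G`; NOT proved here), for every `m`:
`|G - v_{2+m}/u_{2+m}| ≤ K θ^m/(1 - θ)`. -/
theorem abs_sub_catalan_le_of_theorem1 (h : theorem1) (m : ℕ) :
    |catalanConstant - vR (2 + m) / uR (2 + m)| ≤
      13 / 8 / ((649 / 64) ^ 2 * (15 / 2)) * (4 / 225) ^ m / (1 - 4 / 225) := by
  obtain ⟨L, hL, hbound⟩ := exists_limit
  have hlim : Tendsto (fun n : ℕ => vR n / uR n) atTop (𝓝 catalanConstant) := by
    refine h.2.congr fun n => ?_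
    unfold vR uR; push_cast; rfl
  have hLG : L = catalanConstant := tendsto_nhds_unique hL hlim
  rw [← hLG, abs_sub_comm]
  exact hbound m

end Zudilin2003Growth

end Summit.KontsevichZagierPeriods.Zeta5Search
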